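import Literature.IUT.HodgeArakelov.ConstantMonoidRealification
import HarnessLib

/-!
# [IUTchII] Prop 4.1 (iv) (and the splitting clause of (ii)) at good nonarchimedean primes — the printed
# clauses of the theta / Gaussian monoids and of the formal evaluation isomorphism, PROVED
# (proof-only companion of `GaussianMonoidsGood.lean`)

S. Mochizuki, *Inter-universal Teichmüller theory II*, §4 "Global Gaussian Frobenioids", kurims manuscript
(Dec. 2020), Proposition 4.1 (ii) p. 121, (iv) p. 122 (`v ∈ V^good ∩ V^non`) [cite: Mochizuki2012, Prop 4.1 (iv) p.122].
Claim key DISPUTED (D-0012): what is proved below is elementary monoid bookkeeping over the FROZEN statement file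
`GaussianMonoidsGood.lean` (abc-iut-L6-t2, p404520); nothing here asserts a disputed claim and no side is taken on
[IUTchIII] Cor. 3.12. abc-iut cell, DAG nodes **IUTchII:Prop4.1(iv)** (and the `Ψ^ss` splitting clause of
**IUTchII:Prop4.1(ii)**), wave-4 seat abc-iut-w4-d005. PROOF-ONLY: no `def`, no new named fact, no hypothesis structure.

## Print (p. 122) and what the statement file already has

(iv) «`Ψ_env(Π_v) := Ψ_cns(Π_v)^× × {ℝ_{≥0}·log^{Π_v}(p_v)·log^{Π_v}(Θ)}`» = `ConstantMonoidDatum.ThetaMonoid`;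
«`Ψ_gau(Π_v) := Ψ_cns(Π_v)^×_{⟨F_l^⋇⟩} × {ℝ_{≥0}·(…, j²·log^{Π_v}(p_v), …)} ⊆ ∏_{j ∈ F_l^⋇} Ψ^ss_cns(Π_v)_j`» =
`ConstantMonoidDatum.GaussianMonoid` (typed as the IMAGE of the evaluation map); «the formal evaluation isomorphism
`Ψ_env(Π_v) ⥲ Ψ_gau(Π_v)`, `log^{Π_v}(p_v)·log^{Π_v}(Θ) ↦ (…, j²·log^{Π_v}(p_v), …)` — which restricts to the identity on
the respective copies of "`Ψ_cns(Π_v)^×`" and is compatible with the respective natural actions of `G_v(Π_v)` as well as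
with the natural splittings on the domain and codomain» = `evalHom` / `evalIso` with `evalHom_unit`, `evalHom_ray`.

## What this file adds (kernel theorems for the remaining printed clauses)

* `mem_gaussianMonoid_iff` / `mem_gaussianMonoid_iff_diagonal` — **`Ψ_gau` IS the printed product**: a family
  `x ∈ ∏_j Ψ^ss_cns,j` lies in `Ψ_gau` iff its unit components are one DIAGONAL unit (`Ψ_cns^×_{⟨F_l^⋇⟩}`,
  `diagonalSubmonoid`) and its `R_{≥0}`-components are ONE multiple `c·(…, j²·log(p_v), …)` of the vector of
  ratios (the statement file proves only the inclusion `gaussianMonoid_units_diagonal`);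
* `evalHom_generator` — the printed ASSIGNMENT `log(p_v)·log(Θ) ↦ (…, j²·log(p_v), …)` (coefficient `c = 1`);
* `evalHom_comp_inl`, `evalHom_comp_inr_apply`, `map_evalHom_unitPart`, `map_evalHom_rayPart` — «compatible with the
  natural splittings on the domain and codomain»: the evaluation map carries the unit factor `Ψ_cns^× × {0}` of `Ψ_env`
  onto the diagonal units with trivial `R_{≥0}`-part (= «restricts to the identity on the copies of `Ψ_cns^×`» composed
  with the symmetrizing diagonal of (iii)), and the ray `{1} × ℝ_{≥0}·log(p_v)log(Θ)` into the ray of `Ψ_gau`;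
* `evalHom_map_units`, `evalIso_map_units`, `gaussianMonoid_map_units_mem` — «compatible with the respective natural
  actions of `G_v(Π_v)`»: for ANY self-map `σ` of the unit group `Ψ_cns^×` extended by the identity on `R_{≥0}(−)`
  (the natural `G_v(Π_v)`-action on `Ψ^ss_cns = Ψ_cns^× × R_{≥0}(G_v)` is of this shape: the value-group part
  `R_{≥0}(G_v)` is reconstructed from `G_v` alone and carries the trivial action), the evaluation map / isomorphism
  is `σ`-EQUIVARIANT and `Ψ_gau` is `σ`-STABLE inside `∏_j Ψ^ss_cns,j`;
* `evalIso_apply_coe`, `evalIso_symm_apply_evalHom` — the evaluation ISOMORPHISM is the evaluation map on underlying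
  families (bookkeeping for consumers of `evalIso`);
* (ii) `PsiRlf.existsUnique_iso_of_equiv_nnrat` / `_of_equiv_nat` — abc-iut-L6-t2's discharge of the «natural
  isomorphism `Ψ^R_cns(G_v) := (Ψ_cns(G_v)/Ψ_cns(G_v)^×)^rlf ⥲ R_{≥0}(G_v)`» (`PsiRlf.existsUnique_iso`,
  `ConstantMonoidRealification.lean` p406370, hypothesis `IsMonoprime (Ψ/Ψ^×)`) keyed LITERALLY to the printed
  parenthetical «the monoid in parentheses [which is isomorphic to `ℚ_{≥0}`]» (resp. to a discretely valued `Ψ/Ψ^× ≅ ℤ_{≥0}`,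
  the shape at `†F^⊢_v`, Prop 4.2 (ii) «the unique generator of `Ψ_{†F^⊢_v}/Ψ^×_{†F^⊢_v}`»).

The reconstruction clauses (i), (iii) («functorial group-theoretic algorithm in `Π_v`», the `F_l^⋊±`-symmetrizing
isomorphisms from the `Δ^±_v`-outer action) are the interface slots `GoodPlaceReconstructionStatements` of the statement
file (inputs [AbsTopIII] Cor 1.10, [IUTchI] Cor 1.2 / Def 6.1 owned by L4/L5) and are NOT touched here.
-/

namespace Literature.IUT.HodgeArakelov

open scoped NNReal

universe u

namespace ConstantMonoidDatum

variable (Ψ : ConstantMonoidDatum.{u}) (lstar : ℕ)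

/-! ### 1. The evaluation map, unfolded -/

/-- **IUTchII:Prop4.1(iv)** (kurims p.122) The formal evaluation map on an element `(u, c·log(p_v)log(Θ))` of `Ψ_env`,
componentwise: `j ↦ (u, c·j²·log(p_v))`. [cite: Mochizuki2012, Prop 4.1 (iv) p.122] -/
theorem evalHom_apply (x : Ψ.ThetaMonoid) (j : Fin lstar) :
    Ψ.evalHom lstar x j = (x.1, Multiplicative.ofAdd (Ψ.weight lstar (Multiplicative.toAdd x.2) j)) := rfl

/-- **IUTchII:Prop4.1(iv)** (kurims p.122) The unit component of the evaluation map is the unit component of the argument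
(«restricts to the identity on the respective copies of `Ψ_cns(Π_v)^×`»). [cite: Mochizuki2012, Prop 4.1 (iv) p.122] -/
theorem evalHom_apply_fst (x : Ψ.ThetaMonoid) (j : Fin lstar) : (Ψ.evalHom lstar x j).1 = x.1 := rfl

/-- **IUTchII:Prop4.1(iv)** (kurims p.122) The `R_{≥0}`-component of the evaluation map at the label `j` is `c·j²·log(p_v)`.
[cite: Mochizuki2012, Prop 4.1 (iv) p.122] -/
theorem evalHom_apply_snd (x : Ψ.ThetaMonoid) (j : Fin lstar) :
    (Ψ.evalHom lstar x j).2 =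
      Multiplicative.ofAdd (Multiplicative.toAdd x.2 * ((labelNat j : ℝ≥0) ^ 2 * Ψ.logReal.logp)) := rfl

/-- **IUTchII:Prop4.1(iv)** (kurims p.122) The printed ASSIGNMENT of the formal evaluation isomorphism:
«`log^{Π_v}(p_v)·log^{Π_v}(Θ) ↦ (…, j²·log^{Π_v}(p_v), …)`» — the formal symbol (coefficient `c = 1`, trivial unit part)
goes to the vector of ratios. [cite: Mochizuki2012, Prop 4.1 (iv) p.122] -/
theorem evalHom_generator (j : Fin lstar) :
    Ψ.evalHom lstar (1, Multiplicative.ofAdd 1) j =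
      (1, Multiplicative.ofAdd ((labelNat j : ℝ≥0) ^ 2 * Ψ.logReal.logp)) := by
  rw [evalHom_ray, one_mul]

/-! ### 2. `Ψ_gau = Ψ_cns^×_{⟨F_l^⋇⟩} × {ℝ_{≥0}·(…, j²·log(p_v), …)}` as a SET -/

/-- **IUTchII:Prop4.1(iv)** (kurims p.122) **The Gaussian monoid is the printed product.** A family
`x ∈ ∏_{j ∈ F_l^⋇} Ψ^ss_cns,j` belongs to `Ψ_gau` iff there are ONE unit `u ∈ Ψ_cns^×` and ONE coefficient `c ∈ ℝ_{≥0}` with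
`x_j = (u, c·j²·log(p_v))` for every label `j` — i.e. `Ψ_gau = Ψ_cns^×_{⟨F_l^⋇⟩} × {ℝ_{≥0}·(…, j²·log(p_v), …)}`, the diagonal
units times the ray spanned by the vector of ratios. [cite: Mochizuki2012, Prop 4.1 (iv) p.122] -/
theorem mem_gaussianMonoid_iff (x : Fin lstar → Ψ.SemiSimplified) :
    x ∈ Ψ.GaussianMonoid lstar ↔ ∃ (u : Ψ.Units) (c : ℝ≥0), ∀ j,
      x j = (u, Multiplicative.ofAdd (c * ((labelNat j : ℝ≥0) ^ 2 * Ψ.logReal.logp))) := by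
  constructor
  · rintro ⟨y, rfl⟩
    exact ⟨y.1, Multiplicative.toAdd y.2, fun j => rfl⟩
  · rintro ⟨u, c, hx⟩
    refine ⟨(u, Multiplicative.ofAdd c), funext fun j => ?_⟩
    rw [hx j]
    rfl

/-- **IUTchII:Prop4.1(iv)** (kurims p.122) The same, phrased with the DIAGONAL submonoid of (iii): `x ∈ Ψ_gau` iff its unit
components lie in `Ψ_cns(Π_v)^×_{⟨F_l^⋇⟩}` (`diagonalSubmonoid`) and its `R_{≥0}`-components are a common multiple of the
vector of ratios `(…, j²·log(p_v), …)`. (For `l⋇ = 0` both sides hold trivially.) [cite: Mochizuki2012, Prop 4.1 (iv) p.122] -/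
theorem mem_gaussianMonoid_iff_diagonal (x : Fin lstar → Ψ.SemiSimplified) :
    x ∈ Ψ.GaussianMonoid lstar ↔
      (fun j => (x j).1) ∈ diagonalSubmonoid (Fin lstar) Ψ.Units ∧
        ∃ c : ℝ≥0, ∀ j, (x j).2 = Multiplicative.ofAdd (c * ((labelNat j : ℝ≥0) ^ 2 * Ψ.logReal.logp)) := by
  rw [mem_gaussianMonoid_iff]
  constructor
  · rintro ⟨u, c, hx⟩
    refine ⟨fun t t' => ?_, c, fun j => ?_⟩
    · simp only [hx t, hx t']
    · rw [hx j]
  · rintro ⟨hdiag, c, hc⟩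
    rcases Nat.eq_zero_or_pos lstar with h0 | hpos
    · subst h0
      exact ⟨1, c, fun j => j.elim0⟩
    · refine ⟨(x ⟨0, hpos⟩).1, c, fun j => Prod.ext ?_ (hc j)⟩
      exact hdiag j ⟨0, hpos⟩

/-- **IUTchII:Prop4.1(iv)** (kurims p.122) In particular every element of `Ψ_gau` has its `R_{≥0}`-components on the ray of
the vector of ratios (the complement of `gaussianMonoid_units_diagonal`). [cite: Mochizuki2012, Prop 4.1 (iv) p.122] -/
theorem gaussianMonoid_snd_ray {x : Fin lstar → Ψ.SemiSimplified} (hx : x ∈ Ψ.GaussianMonoid lstar) :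
    ∃ c : ℝ≥0, ∀ j, (x j).2 = Multiplicative.ofAdd (c * ((labelNat j : ℝ≥0) ^ 2 * Ψ.logReal.logp)) :=
  ((Ψ.mem_gaussianMonoid_iff_diagonal lstar x).1 hx).2

/-! ### 3. Compatibility with the natural splittings (domain `Ψ_env = Ψ_cns^× × ray`, codomain
`Ψ_gau = Ψ_cns^×_{⟨F_l^⋇⟩} × ray`) -/

/-- **IUTchII:Prop4.1(iv)** (kurims p.122) «restricts to the identity on the respective copies of `Ψ_cns(Π_v)^×`»
∘ (iii)'s diagonal: on the unit factor of `Ψ_env` the evaluation map IS the diagonal (symmetrizing) embedding of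
`Ψ^ss_cns` restricted to `Ψ_cns^× × {0}` — an identity of monoid homomorphisms. [cite: Mochizuki2012, Prop 4.1 (iv) p.122] -/
theorem evalHom_comp_inl :
    (Ψ.evalHom lstar).comp (MonoidHom.inl Ψ.Units (Multiplicative ℝ≥0)) =
      (diagonalEmbedding (Fin lstar) Ψ.SemiSimplified).comp
        (MonoidHom.inl Ψ.Units (Multiplicative ℝ≥0)) := by
  ext u j <;> simp [evalHom_unit, diagonalEmbedding]

/-- **IUTchII:Prop4.1(iv)** (kurims p.122) Compatibility with the splittings, ray factor: on `{1} × ℝ_{≥0}·log(p_v)log(Θ)` the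
evaluation map has trivial unit components and `R_{≥0}`-components `c·j²·log(p_v)` (the map `c ↦ c·j²·log(p_v)` being
additive in `c`). [cite: Mochizuki2012, Prop 4.1 (iv) p.122] -/
theorem evalHom_comp_inr_apply (r : Multiplicative ℝ≥0) (j : Fin lstar) :
    (Ψ.evalHom lstar).comp (MonoidHom.inr Ψ.Units (Multiplicative ℝ≥0)) r j =
      (1, Multiplicative.ofAdd (Multiplicative.toAdd r * ((labelNat j : ℝ≥0) ^ 2 * Ψ.logReal.logp))) := by
  simp [evalHom_apply, weight]

/-- **IUTchII:Prop4.1(iv)** (kurims p.122) IMAGE form of the splitting compatibility, unit factor: the evaluation map carries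
the unit factor `Ψ_cns^× × {0} ⊆ Ψ_env` EXACTLY onto the families `j ↦ (u, 0)` — the diagonal units with trivial
`R_{≥0}`-part, `Ψ_cns^×_{⟨F_l^⋇⟩} × {0} ⊆ Ψ_gau`. [cite: Mochizuki2012, Prop 4.1 (iv) p.122] -/
theorem map_evalHom_unitPart :
    Submonoid.map (Ψ.evalHom lstar) (MonoidHom.mrange (MonoidHom.inl Ψ.Units (Multiplicative ℝ≥0))) =
      MonoidHom.mrange ((diagonalEmbedding (Fin lstar) Ψ.SemiSimplified).comp
        (MonoidHom.inl Ψ.Units (Multiplicative ℝ≥0))) := by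
  rw [← MonoidHom.mrange_comp, evalHom_comp_inl]

/-- **IUTchII:Prop4.1(iv)** (kurims p.122) IMAGE form of the splitting compatibility, ray factor: the evaluation map carries the
ray `{1} × ℝ_{≥0}·log(p_v)log(Θ) ⊆ Ψ_env` EXACTLY onto the ray `{1} × ℝ_{≥0}·(…, j²·log(p_v), …) ⊆ Ψ_gau`, i.e. onto the
families with trivial unit components and `R_{≥0}`-components a common multiple of the vector of ratios.
[cite: Mochizuki2012, Prop 4.1 (iv) p.122] -/
theorem map_evalHom_rayPart (x : Fin lstar → Ψ.SemiSimplified) :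
    x ∈ Submonoid.map (Ψ.evalHom lstar) (MonoidHom.mrange (MonoidHom.inr Ψ.Units (Multiplicative ℝ≥0))) ↔
      ∃ c : ℝ≥0, ∀ j, x j = (1, Multiplicative.ofAdd (c * ((labelNat j : ℝ≥0) ^ 2 * Ψ.logReal.logp))) := by
  constructor
  · rintro ⟨y, ⟨r, rfl⟩, rfl⟩
    exact ⟨Multiplicative.toAdd r, fun j => by simp [evalHom_apply, weight]⟩
  · rintro ⟨c, hc⟩
    refine ⟨(1, Multiplicative.ofAdd c), ⟨Multiplicative.ofAdd c, rfl⟩, funext fun j => ?_⟩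
    rw [hc j]
    simp [evalHom_apply, weight]

/-- **IUTchII:Prop4.1(ii)** (kurims p.121) The tautological SPLITTING of the mono-analytic semi-simplification
`Ψ^ss_cns := Ψ_cns^× × R_{≥0}(G_v)`: every element is the product of its unit part and its `R_{≥0}`-part, uniquely
(the two factors meet in the identity). [cite: Mochizuki2012, Prop 4.1 (ii) p.121] -/
theorem semiSimplified_splitting (s : Ψ.SemiSimplified) :
    s = (MonoidHom.inl Ψ.Units (Multiplicative ℝ≥0)) s.1 * (MonoidHom.inr Ψ.Units (Multiplicative ℝ≥0)) s.2 ∧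
      ∀ (u : Ψ.Units) (r : Multiplicative ℝ≥0),
        s = (MonoidHom.inl Ψ.Units (Multiplicative ℝ≥0)) u * (MonoidHom.inr Ψ.Units (Multiplicative ℝ≥0)) r →
          u = s.1 ∧ r = s.2 := by
  refine ⟨Prod.ext (by simp) (by simp), fun u r h => ?_⟩
  subst h
  simp

/-- **IUTchII:Prop4.1(iv)** (kurims p.122) The same splitting for the theta monoid `Ψ_env = Ψ_cns^× × ℝ_{≥0}·log(p_v)log(Θ)`:
unit part and ray part, meeting in the identity. [cite: Mochizuki2012, Prop 4.1 (iv) p.122] -/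
theorem thetaMonoid_splitting (x : Ψ.ThetaMonoid) :
    x = (MonoidHom.inl Ψ.Units (Multiplicative ℝ≥0)) x.1 * (MonoidHom.inr Ψ.Units (Multiplicative ℝ≥0)) x.2 :=
  Prod.ext (by simp) (by simp)

/-- **IUTchII:Prop4.1(iv)** (kurims p.122) The evaluation map RESPECTS the splittings factor by factor: the image of
`x = (unit part)·(ray part)` is `(diagonal unit part)·(ray part of the vector of ratios)`.
[cite: Mochizuki2012, Prop 4.1 (iv) p.122] -/
theorem evalHom_splitting (x : Ψ.ThetaMonoid) :
    Ψ.evalHom lstar x =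
      diagonalEmbedding (Fin lstar) Ψ.SemiSimplified ((MonoidHom.inl Ψ.Units (Multiplicative ℝ≥0)) x.1) *
        (Ψ.evalHom lstar).comp (MonoidHom.inr Ψ.Units (Multiplicative ℝ≥0)) x.2 := by
  conv_lhs => rw [Ψ.thetaMonoid_splitting x, map_mul]
  congr 1
  exact congrFun (congrArg DFunLike.coe (Ψ.evalHom_comp_inl lstar)) x.1

/-! ### 4. Compatibility with the natural `G_v(Π_v)`-actions -/

/-- **IUTchII:Prop4.1(iv)** (kurims p.122) «compatible with the respective natural actions of `G_v(Π_v)`»: for ANY self-map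
`σ` of the unit group `Ψ_cns^×` extended by the identity on the value-group part `R_{≥0}(−)` — the shape of the natural
`G_v(Π_v)`-action on `Ψ_env = Ψ_cns^× × ray` and, diagonally, on `∏_j Ψ^ss_cns,j` — the evaluation map is `σ`-EQUIVARIANT.
[cite: Mochizuki2012, Prop 4.1 (iv) p.122] -/
theorem evalHom_map_units (σ : Ψ.Units → Ψ.Units) (x : Ψ.ThetaMonoid) :
    Ψ.evalHom lstar (Prod.map σ id x) = fun j => Prod.map σ id (Ψ.evalHom lstar x j) := rfl

/-- **IUTchII:Prop4.1(iv)** (kurims p.122) Hence `Ψ_gau ⊆ ∏_j Ψ^ss_cns,j` is STABLE under the diagonal action of any such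
`σ` (the natural `G_v(Π_v)`-action on the Gaussian monoid is the restricted diagonal one).
[cite: Mochizuki2012, Prop 4.1 (iv) p.122] -/
theorem gaussianMonoid_map_units_mem (σ : Ψ.Units → Ψ.Units) {x : Fin lstar → Ψ.SemiSimplified}
    (hx : x ∈ Ψ.GaussianMonoid lstar) : (fun j => Prod.map σ id (x j)) ∈ Ψ.GaussianMonoid lstar := by
  obtain ⟨y, rfl⟩ := hx
  exact ⟨Prod.map σ id y, Ψ.evalHom_map_units lstar σ y⟩

/-- **IUTchII:Prop4.1(iv)** (kurims p.122) The evaluation ISOMORPHISM on underlying families is the evaluation map.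
[cite: Mochizuki2012, Prop 4.1 (iv) p.122] -/
theorem evalIso_apply_coe (hl : 0 < lstar) (x : Ψ.ThetaMonoid) :
    ((Ψ.evalIso lstar hl x : Ψ.GaussianMonoid lstar) : Fin lstar → Ψ.SemiSimplified) = Ψ.evalHom lstar x := rfl

/-- **IUTchII:Prop4.1(iv)** (kurims p.122) The inverse of the evaluation isomorphism undoes the evaluation map.
[cite: Mochizuki2012, Prop 4.1 (iv) p.122] -/
theorem evalIso_symm_apply_evalHom (hl : 0 < lstar) (x : Ψ.ThetaMonoid) :
    (Ψ.evalIso lstar hl).symm ⟨Ψ.evalHom lstar x, ⟨x, rfl⟩⟩ = x :=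
  (Ψ.evalIso lstar hl).injective (by rw [MulEquiv.apply_symm_apply]; rfl)

/-- **IUTchII:Prop4.1(iv)** (kurims p.122) Equivariance of the evaluation ISOMORPHISM: transporting the unit part by `σ`
before evaluating = acting diagonally by `σ` on the evaluated family. [cite: Mochizuki2012, Prop 4.1 (iv) p.122] -/
theorem evalIso_map_units (hl : 0 < lstar) (σ : Ψ.Units → Ψ.Units) (x : Ψ.ThetaMonoid) :
    ((Ψ.evalIso lstar hl (Prod.map σ id x) : Ψ.GaussianMonoid lstar) : Fin lstar → Ψ.SemiSimplified) =
      fun j => Prod.map σ id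
        (((Ψ.evalIso lstar hl x : Ψ.GaussianMonoid lstar) : Fin lstar → Ψ.SemiSimplified) j) := by
  rw [evalIso_apply_coe, evalIso_apply_coe, evalHom_map_units]

/-- **IUTchII:Prop4.1(iv)** (kurims p.122) Equivariance read on the INVERSE: the element of `Ψ_env` evaluating to the
`σ`-translate of `evalIso x` is the `σ`-translate of `x`. [cite: Mochizuki2012, Prop 4.1 (iv) p.122] -/
theorem evalIso_symm_map_units (hl : 0 < lstar) (σ : Ψ.Units → Ψ.Units) (x : Ψ.ThetaMonoid) :
    (Ψ.evalIso lstar hl).symm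
        ⟨fun j => Prod.map σ id
            (((Ψ.evalIso lstar hl x : Ψ.GaussianMonoid lstar) : Fin lstar → Ψ.SemiSimplified) j),
          Ψ.gaussianMonoid_map_units_mem lstar σ (Ψ.evalIso lstar hl x).2⟩ =
      Prod.map σ id x := by
  apply (Ψ.evalIso lstar hl).injective
  rw [MulEquiv.apply_symm_apply]
  exact Subtype.ext (Ψ.evalIso_map_units lstar hl σ x).symm

/-- **IUTchII:Prop4.1(iv)** (kurims p.122) «restricts to the identity on the respective copies of `Ψ_cns(Π_v)^×`», inverse
direction: the evaluation isomorphism pulls the diagonal unit family `j ↦ (u, 0)` back to `(u, 0) ∈ Ψ_env`.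
[cite: Mochizuki2012, Prop 4.1 (iv) p.122] -/
theorem evalIso_symm_unit (hl : 0 < lstar) (u : Ψ.Units) :
    (Ψ.evalIso lstar hl).symm ⟨fun _ => (u, 1), ⟨(u, 1), funext fun j => Ψ.evalHom_unit lstar u j⟩⟩ = (u, 1) :=
  (Ψ.evalIso lstar hl).injective (by
    rw [MulEquiv.apply_symm_apply]
    exact Subtype.ext (funext fun j => (Ψ.evalHom_unit lstar u j).symm))

end ConstantMonoidDatum

/-! ### 5. Prop 4.1 (ii): the natural isomorphism `Ψ^R_cns ⥲ R_{≥0}(G_v)` under the PRINTED hypothesis shape -/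

namespace PsiRlf

variable {Ψ : Type u} [CommMonoid Ψ]

/-- **IUTchII:Prop4.1(ii)** (kurims p.121) «a natural isomorphism `Ψ^R_cns(G_v) := (Ψ_cns(G_v)/Ψ_cns(G_v)^×)^rlf ⥲ R_{≥0}(G_v)`
… the realification [which is isomorphic to `ℝ_{≥0}`] of the monoid in parentheses [which is isomorphic to `ℚ_{≥0}`] — and a
distinguished element `log^{G_v}(p_v) ∈ R_{≥0}(G_v)`»: for a commutative monoid `Ψ` whose monoid of associates `Ψ/Ψ^×` is
isomorphic to `ℚ_{≥0}` (the printed parenthetical, verbatim) and a non-unit `p ∈ Ψ`, there is EXACTLY ONE isomorphism of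
monoids `(Ψ/Ψ^×)^rlf ⥲ ℝ_{≥0} = R_{≥0}(G_v)` carrying the class of `p` to the distinguished element `log(p_v)`
(abc-iut-L6-t2's `existsUnique_iso` at `IsMonoprime.ofQ`). [cite: Mochizuki2012, Prop 4.1 (ii) p.121] -/
theorem existsUnique_iso_of_equiv_nnrat (e : Associates Ψ ≃* Multiplicative ℚ≥0) {p : Ψ} (hp : ¬ IsUnit p)
    (D : LogRealDatum) :
    ∃! ι : PsiRlf Ψ ≃* Multiplicative ℝ≥0, ι (logp p) = Multiplicative.ofAdd D.logp :=
  existsUnique_iso (Literature.AlgebraicGeometry.Frobenioids.IsMonoprime.ofQ ⟨⟨e⟩⟩) hp D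

/-- **IUTchII:Prop4.1(ii)** (kurims p.121) The same for a DISCRETELY valued constant monoid, `Ψ/Ψ^× ≅ ℤ_{≥0}` (the shape of
`Ψ_{†F^⊢_v}/Ψ^×_{†F^⊢_v}` with its «unique generator», Prop 4.2 (ii) p.124, and of `O^▷_{K_v}` for a finite extension `K_v`
of `ℚ_{p_v}`): exactly one isomorphism `(Ψ/Ψ^×)^rlf ⥲ ℝ_{≥0}` with the printed normalisation.
[cite: Mochizuki2012, Prop 4.1 (ii) p.121] -/
theorem existsUnique_iso_of_equiv_nat (e : Associates Ψ ≃* Multiplicative ℕ) {p : Ψ} (hp : ¬ IsUnit p)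
    (D : LogRealDatum) :
    ∃! ι : PsiRlf Ψ ≃* Multiplicative ℝ≥0, ι (logp p) = Multiplicative.ofAdd D.logp :=
  existsUnique_iso (Literature.AlgebraicGeometry.Frobenioids.IsMonoprime.ofZ ⟨⟨e⟩⟩) hp D

/-- **IUTchII:Prop4.1(ii)** (kurims p.121) … and then the semi-simplification built from the GENUINE realification,
`Ψ_cns^× × Ψ^R_cns`, is identified with the statement file's `Ψ^ss_cns = Ψ_cns^× × R_{≥0}(G_v)` compatibly with the
splittings: the identification is the identity on the unit factor and the normalised isomorphism on the realified
factor (abc-iut-L6-t2's `semiSimplifiedRlfEquiv`, unfolded). [cite: Mochizuki2012, Prop 4.1 (ii) p.121] -/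
theorem semiSimplifiedRlfEquiv_apply (h : Literature.AlgebraicGeometry.Frobenioids.IsMonoprime (Associates Ψ))
    {p : Ψ} (hp : ¬ IsUnit p) (D : LogRealDatum) (x : SemiSimplifiedRlf Ψ) :
    semiSimplifiedRlfEquiv h hp D x = (x.1, toNNReal h hp D x.2) := rfl

end PsiRlf

end Literature.IUT.HodgeArakelov
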